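import Summits.QuantumFields.QCD.Theses.NestedDissectionSea
import Summits.QuantumFields.QCD.Theorems.NestedDissectionSeaNegativeCellsDiluteStubDefectCrossing
import Summits.QuantumFields.QCD.Theorems.NestedDissectionSeaNegativeCellsDiluteStubBoxGroundState
import Summits.QuantumFields.QCD.Theorems.NestedDissectionSeaNegativeCellsDiluteStubKineticEdgeCell
import Summits.QuantumFields.QCD.Theorems.NestedDissectionSeaNegativeCellsDiluteStubSojourn
import Summits.QuantumFields.QCD.Theorems.NestedDissectionSeaNegativeCellsDiluteStubReverseWegnerCount
import Summits.QuantumFields.QCD.Theorems.NestedDissectionSeaNegativeCellsDiluteStubSignMobility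
import Summits.QuantumFields.QCD.Theorems.NestedDissectionSeaNegativeCellsDiluteStubConcentration
import Summits.QuantumFields.QCD.Theorems.NestedDissectionSeaNegativeCellsDiluteStubPinOfFloor
import Literature.MathematicalPhysics.QuantumFieldTheory.QCDPhaseQuenched

/-!
# Line `mass-wegner-cell-index` — crux `NegativeCellsDilute` (stmt-QuantumFields-13900) — LEAD'S SKELETON v5

Lead prover-line-stmt-QuantumFields-13900-0, 2026-08-16; re-registered unchanged by the continuation lead
prover-line-stmt-QuantumFields-13900-1 (2026-08-16T10:2xZ; `ledger skeleton check` OK, one `sorry`: `stub_tunedStripWitness`).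

## History of the skeleton
* v1–v2 (03:3xZ): planner's stub 1 split into `stub_defectCrossing` / `stub_boxGroundState` /
  `stub_kineticEdgeCell` / `stub_sojourn`; stubs 2–3 verbatim. 6 registered stubs.
* v3 (05:5xZ): the five provable stubs LANDED under `Theorems/` (imported above, cited by name):
  `stub_defectCrossing` (p82450), `stub_boxGroundState` (p83380), `stub_kineticEdgeCell` (p82363), `stub_sojourn`
  (p82978), `stub_reverseWegnerCount` (p83182). One `sorry` left: the transfer `stub_pinnedStripLaw` = (a⁺) ∧ (b).
* v4 (06:0xZ; registered 09:56Z): the GRAFT. The transfer's second conjunct — the crux's parity pin (b), VERBATIM, the clause the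
  standing disprover showed to be the crux's sole junk-proof content — is replaced by the typed transfer of the crux
  idea `sign-mobility-identity` (triage r1-2/r1-3 PASS; its line card invites exactly this graft): BLOCK FLOOR
  (`E_pq m_b ≥ p₀` for the heat-bath flip propensity `m_b` of every link block of physical side `L_b`) and RATIO MIXING
  (`Cov_pq(m_b, m_b′) ≤ θ E m_b E m_b′` for blocks `d₀` apart, `θ ≤ 1/8`), under the SAME `reg`, together with the three
  PROVABLE-NOW stubs of that idea which certify `floor ∧ mixing ⇒ pin`: `stub_signMobility` (heat-bath orthogonality
  `E_pq[σ · m_B] = 0` for every link set `B`), `stub_concentration` (second-moment concentration ⇒ quarter pin; pure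
  probability) and `stub_pinOfFloor` (torus block grid + identification of the crux's quotient). The old transfer is now
  the sorry-free glue theorem `pinnedStripLaw` below; the new open stub is `stub_tunedStripWitness` = admissibility ∧
  (a⁺) ∧ floor ∧ mixing under ONE `reg` — every conjunct a ONE-SIDED estimate (an upper bound on a linear spectral
  statistic, a lower bound on a conditional flip propensity, a relative covariance bound); no parity / `≥ 1/4` clause
  is left in the open stub. Registered stubs of v4: `stub_signMobility`, `stub_concentration`, `stub_pinOfFloor`
  (provable now, fanned out) and `stub_tunedStripWitness` (OPEN, the lead's); with the five landed ones, 9 names in all.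
* v5 (this file): the three provable stubs of the graft LANDED under `Theorems/` (imported above, cited by name):
  `stub_signMobility` (p93848), `stub_concentration` (p95296), `stub_pinOfFloor` (p93706). EIGHT of nine registered stubs
  are landed; the ONLY `sorry` left in the skeleton is the open physics `stub_tunedStripWitness` (crux-sized: through the
  eight certified reductions it implies the crux; it is the planners' to promote / re-line).

## Architecture
`NegativeCellsDilute_of` (planner's composition, unchanged) ⇐ `reverseWegnerSojourn` (landed stubs 1a–1c) +
`stub_reverseWegnerCount` (landed) + `pinnedStripLaw` (glue: ⇐ `stub_signMobility`, `stub_concentration`,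
`stub_pinOfFloor`, `stub_tunedStripWitness`). All stub signatures are over TREE VOCABULARY ONLY (`let`-inlined
`σ = detSign`, `w = pqWeight`, `r = refit`, `m_B = flipRate`, block/apartness predicates), so each lands as a pure
proof under `Theorems/` with nothing but tree imports.

## Disproof used (`Cruxes/NegativeCellsDilute/Disproof.lean` v5.2, NO KILL, no `_false_without_` theorem) and drefute
§ 2/§ 4 sandwich (`withoutPin_holds`, `crux_of_highLinePin`; drefuter's `PinnedStripLawHighLine.lean`: `HighLinePin → C⁺`):
(a)/(a⁺) alone are junk-true on a high line ⇒ the (b)-replacement (floor ∧ mixing) rides in the open stub under the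
same `∃ reg`; the floor kills the same junk witnesses as the pin (sign-mobility skeleton's `blockFloor_window`: outside
`[−8,0]` the flip propensity vanishes identically, so `E m_b = 0 < p₀`). drefute SURVIVED.md (03:56Z): 0 stub-false,
0 stub-misstated on v2; η-briefing for (a⁺): the prover's `η` must be `o(a_k m_min/Z_m(k))` at the strip bottom and
`≲ 0.4 a_k/ℓ` at the strip top (free-cell `σ_min ≈ 2.1/s`, kit j011953) — allowed by the quantifier order (`∃ η`
after `k, S`), recorded in the docstring of `stub_tunedStripWitness`.
-/

noncomputable section

namespace Summit.QuantumFields.QCD.Cruxes.NegativeCellsDilute.MassWegnerCellIndex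

open scoped BigOperators ENNReal Classical
open MeasureTheory Filter
open Literature.MathematicalPhysics.QuantumLattice Literature.MathematicalPhysics.QuantumFieldTheory
  Literature.Probability.LatticeModels
open Summit.QuantumFields.QCD.Theses.NestedDissectionSea (NegativeCellsDilute)

/-! ### Landed stubs (imported from `Theorems/`, cited by name below)

* `stub_defectCrossing` — `Theorems/NestedDissectionSeaNegativeCellsDiluteStubDefectCrossing.lean` (p82450)
* `stub_boxGroundState` — `Theorems/NestedDissectionSeaNegativeCellsDiluteStubBoxGroundState.lean` (p83380)
* `stub_kineticEdgeCell` — `Theorems/NestedDissectionSeaNegativeCellsDiluteStubKineticEdgeCell.lean` (p82363)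
* `stub_sojourn` — `Theorems/NestedDissectionSeaNegativeCellsDiluteStubSojourn.lean` (p82978)
* `stub_reverseWegnerCount` — `Theorems/NestedDissectionSeaNegativeCellsDiluteStubReverseWegnerCount.lean` (p83182)
-/

/-! ## Registered stubs (`sorry` lives only in `stub_tunedStripWitness`; signatures over tree vocabulary only) -/

/-! ### Landed stubs of wave 2 (imported from `Theorems/`, cited by name in `pinnedStripLaw`)

* `stub_signMobility` — `Theorems/NestedDissectionSeaNegativeCellsDiluteStubSignMobility.lean` (p93848)
* `stub_concentration` — `Theorems/NestedDissectionSeaNegativeCellsDiluteStubConcentration.lean` (p95296)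
* `stub_pinOfFloor` — `Theorems/NestedDissectionSeaNegativeCellsDiluteStubPinOfFloor.lean` (p93706)
-/

/-- **Stub 3d — `tunedStripWitness` (THE TUNED WITNESS: ONE regularisation carrying the strip law, the block floor and
the ratio mixing; OPEN — the line's hardest stub, held by the lead; crux-sized).** For `N_f ∈ {2,3}` ONE
mass-independent `reg` (HasMassScaling, HasAsymptoticScaling) with `M₀, b₀, ℓ` such that every mass tuple `m > M₀` has a
physical size `R`, block data `L_b, d₀ > 0`, a floor `p₀ > 0` and a mixing constant `θ ≤ 1/8` with
(a⁺) the WINDOWED STRIP LAW of this line (planner's stub 3 first conjunct, verbatim: for every `ε > 0`, eventually in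
`k`, on every odd torus of physical side `≥ R`, a tolerance `η > 0` and levels `δ_j ≥ 0`, `Σ_{j<J} δ_j ≤ ε`, bound the
strip statistic `η⁻¹ Σ_f ∫_{[m_f(k), η − edge(s)]} P_k(near_η(·, μ′)) dμ′` of every corner-`0` window box at scale
`j`; drefute η-briefing: take `η = o(a_k m_min/Z_m(k))` and `≲ 0.4 a_k/ℓ`), AND
(floor ∧ mixing) for the same `reg` with threshold `R`: for every `M > M₀`, eventually in `k`, on every odd torus of
physical side `≥ R`, every link block of side `⌈L_b/a_k⌉` has `⟨m_b⟩₊ ≥ p₀` at probe `mcrit k − a_k M/Z_m k`, and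
`⌈d₀/a_k⌉`-apart blocks have relative covariance `≤ θ`. Why open: (a⁺) is a Lifshitz-tail / large-deviation bound
for η-near-kernels of mesoscopic Dirichlet cells under the phase-quenched SU(3) measure up to the window scale; the
floor is a k-uniform semiclassical LOWER bound on the conditional parity-flip propensity of one physical block
(Bałaban/MRS corner); the mixing is clustering of the pq measure at physical separation. Why the three cannot be
separate stubs: they are coupled through the shared witness `reg` ((a⁺) alone holds on the heavy junk line
`mcrit ≡ 1` with empty strips; the floor alone on `mcrit ≡ −1`). -/
theorem stub_tunedStripWitness :
    ∀ Nf : ℕ, (Nf = 2 ∨ Nf = 3) → ∃ reg : QCDRegularisation Nf, reg.HasMassScaling ∧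
      (reg.scheme 0 0 0).HasAsymptoticScaling ∧ ∃ M₀ : ℝ, 0 ≤ M₀ ∧ ∃ b₀ : ℕ, 2 ≤ b₀ ∧ ∃ ℓ : ℝ, 0 < ℓ ∧
      ∀ m : Fin Nf → ℝ, (∀ f, M₀ < m f) → ∃ R : ℝ, 0 < R ∧
      ∃ Lb d₀ p₀ θ : ℝ, 0 < Lb ∧ 0 < d₀ ∧ 0 < p₀ ∧ 0 ≤ θ ∧ θ ≤ 1 / 8 ∧
      (∀ ε : ℝ, 0 < ε → ∀ᶠ k : ℕ in Filter.atTop, ∀ S : ℕ, R ≤ reg.a k * (2 * S + 1) →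
        ∃ η : ℝ, 0 < η ∧ ∃ δ : ℕ → ℝ, (∀ j, 0 ≤ δ j) ∧
          ∑ j ∈ Finset.range (Nat.log 2 (⌊ℓ / reg.a k⌋₊ / b₀) + 1), δ j ≤ ε ∧
          ∀ j < Nat.log 2 (⌊ℓ / reg.a k⌋₊ / b₀) + 1, ∀ s : Fin 4 → ℕ,
            (∀ i, b₀ * 2 ^ j ≤ s i ∧ s i < b₀ * 2 ^ (j + 2) ∧ s i ≤ 2 * S + 1 ∧ (s i : ℝ) * reg.a k ≤ ℓ) →
            η⁻¹ * ∑ f, (∫⁻ μ' in Set.Icc (reg.mcrit k + reg.a k * m f / reg.Zm k) (η - ∑ i, (1 - Real.cos (Real.pi / s i))),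
              ENNReal.ofReal
                ((∫ U : GaugeConfig 4 (2 * S + 1) (Matrix.specialUnitaryGroup (Fin 3) ℂ), (if ((∃ v : {p // wilsonBox (0 : TorusSite 4 (2 * S + 1)) s p} → ℂ, v ≠ 0 ∧
                      ∑ p, ‖(wilsonCell U μ' 0 s).mulVec v p‖ ^ 2 < η ^ 2 * ∑ p, ‖v p‖ ^ 2) ∨
                    ∃ c : Fin 4 → Bool, ∃ v : {p // wilsonBox (halfCorner s c : TorusSite 4 (2 * S + 1)) (halfSides s c) p} → ℂ,
                      v ≠ 0 ∧ ∑ p, ‖(wilsonCell U μ' (halfCorner s c) (halfSides s c)).mulVec v p‖ ^ 2 <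
                        η ^ 2 * ∑ p, ‖v p‖ ^ 2) then (1 : ℝ) else 0) *
                      ∏ f, ‖fermionDet (wilsonDirac (fundamentalRep (Fin 3)) U (reg.mcrit k + reg.a k * m f / reg.Zm k) 1)‖ ∂(wilsonMeasure (fundamentalRep (Fin 3)) (reg.β k))) /
                  (∫ U : GaugeConfig 4 (2 * S + 1) (Matrix.specialUnitaryGroup (Fin 3) ℂ),
                      ∏ f, ‖fermionDet (wilsonDirac (fundamentalRep (Fin 3)) U (reg.mcrit k + reg.a k * m f / reg.Zm k) 1)‖ ∂(wilsonMeasure (fundamentalRep (Fin 3)) (reg.β k))))).toReal ≤ δ j) ∧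
      (∀ M : ℝ, M₀ < M → ∀ᶠ k : ℕ in Filter.atTop, ∀ S : ℕ, R ≤ reg.a k * (2 * S + 1) →
        let N : ℕ := 2 * S + 1
        let mq : Fin Nf → ℝ := fun f => reg.mcrit k + reg.a k * m f / reg.Zm k
        let μp : ℝ := reg.mcrit k - reg.a k * M / reg.Zm k
        let n : ℕ := ⌈Lb / reg.a k⌉₊
        let g : ℕ := ⌈d₀ / reg.a k⌉₊
        let σ : GaugeConfig 4 N SU3 → ℝ := fun U =>
          if (fermionDet (wilsonDirac (fundamentalRep (Fin 3)) U μp 1)).re < 0 then -1 else 1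
        let w : GaugeConfig 4 N SU3 → ℝ := fun U =>
          Real.exp (-(reg.β k * wilsonAction (fundamentalRep (Fin 3)) U)) *
            ∏ f, ‖fermionDet (wilsonDirac (fundamentalRep (Fin 3)) U (mq f) 1)‖
        let blk : TorusSite 4 N → Finset (Edge 4 N) := fun x =>
          Finset.univ.filter fun e => ∀ i, (e.1 i - x i).val < n
        let r : Finset (Edge 4 N) → GaugeConfig 4 N SU3 → GaugeConfig 4 N SU3 → GaugeConfig 4 N SU3 :=
          fun B U V e => if e ∈ B then V e else U e
        let mb : TorusSite 4 N → GaugeConfig 4 N SU3 → ℝ := fun x U =>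
          (∫ V, (if σ (r (blk x) U V) ≠ σ U then (1 : ℝ) else 0) * w (r (blk x) U V)
              ∂(Measure.pi fun _ : Edge 4 N => haarProbability SU3)) /
            (∫ V, w (r (blk x) U V) ∂(Measure.pi fun _ : Edge 4 N => haarProbability SU3))
        (∀ x : TorusSite 4 N, p₀ ≤ qcdPhaseQuenchedExpect (reg.β k) N mq (mb x)) ∧
        (∀ x x' : TorusSite 4 N,
          (∃ i : Fin 4, ∀ t t' : ℕ, t < n → t' < n →
            g ≤ ((x i + (t : ZMod N)) - (x' i + (t' : ZMod N))).val ∧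
              g ≤ ((x' i + (t' : ZMod N)) - (x i + (t : ZMod N))).val) →
          qcdPhaseQuenchedExpect (reg.β k) N mq (fun U => mb x U * mb x' U) -
              qcdPhaseQuenchedExpect (reg.β k) N mq (mb x) * qcdPhaseQuenchedExpect (reg.β k) N mq (mb x') ≤
            θ * (qcdPhaseQuenchedExpect (reg.β k) N mq (mb x) *
              qcdPhaseQuenchedExpect (reg.β k) N mq (mb x')))) := by
  sorry

/-! ## Glue (PROVED, no `sorry`) -/

/-- **The planner's transfer `C⁺` (`pinnedStripLaw`, formerly the registered stub 3), now a theorem from stubs 3a–3d.**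
Same prefix as the crux; (a⁺) the windowed strip law and (b) the parity pin verbatim, under ONE `reg`: the witness
data come from `stub_tunedStripWitness`; `stub_pinOfFloor` (fed `stub_signMobility`, `stub_concentration`) turns
floor + mixing into the pin on all tori of physical side `≥ R₀`; answer with `max R R₀` ((a⁺) is monotone in `R`). -/
theorem pinnedStripLaw :
    ∀ Nf : ℕ, (Nf = 2 ∨ Nf = 3) → ∃ reg : QCDRegularisation Nf, reg.HasMassScaling ∧
      (reg.scheme 0 0 0).HasAsymptoticScaling ∧ ∃ M₀ : ℝ, 0 ≤ M₀ ∧ ∃ b₀ : ℕ, 2 ≤ b₀ ∧ ∃ ℓ : ℝ, 0 < ℓ ∧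
      ∀ m : Fin Nf → ℝ, (∀ f, M₀ < m f) → ∃ R : ℝ, 0 < R ∧
      (∀ ε : ℝ, 0 < ε → ∀ᶠ k : ℕ in Filter.atTop, ∀ S : ℕ, R ≤ reg.a k * (2 * S + 1) →
        ∃ η : ℝ, 0 < η ∧ ∃ δ : ℕ → ℝ, (∀ j, 0 ≤ δ j) ∧
          ∑ j ∈ Finset.range (Nat.log 2 (⌊ℓ / reg.a k⌋₊ / b₀) + 1), δ j ≤ ε ∧
          ∀ j < Nat.log 2 (⌊ℓ / reg.a k⌋₊ / b₀) + 1, ∀ s : Fin 4 → ℕ,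
            (∀ i, b₀ * 2 ^ j ≤ s i ∧ s i < b₀ * 2 ^ (j + 2) ∧ s i ≤ 2 * S + 1 ∧ (s i : ℝ) * reg.a k ≤ ℓ) →
            η⁻¹ * ∑ f, (∫⁻ μ' in Set.Icc (reg.mcrit k + reg.a k * m f / reg.Zm k) (η - ∑ i, (1 - Real.cos (Real.pi / s i))),
              ENNReal.ofReal
                ((∫ U : GaugeConfig 4 (2 * S + 1) (Matrix.specialUnitaryGroup (Fin 3) ℂ), (if ((∃ v : {p // wilsonBox (0 : TorusSite 4 (2 * S + 1)) s p} → ℂ, v ≠ 0 ∧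
                      ∑ p, ‖(wilsonCell U μ' 0 s).mulVec v p‖ ^ 2 < η ^ 2 * ∑ p, ‖v p‖ ^ 2) ∨
                    ∃ c : Fin 4 → Bool, ∃ v : {p // wilsonBox (halfCorner s c : TorusSite 4 (2 * S + 1)) (halfSides s c) p} → ℂ,
                      v ≠ 0 ∧ ∑ p, ‖(wilsonCell U μ' (halfCorner s c) (halfSides s c)).mulVec v p‖ ^ 2 <
                        η ^ 2 * ∑ p, ‖v p‖ ^ 2) then (1 : ℝ) else 0) *
                      ∏ f, ‖fermionDet (wilsonDirac (fundamentalRep (Fin 3)) U (reg.mcrit k + reg.a k * m f / reg.Zm k) 1)‖ ∂(wilsonMeasure (fundamentalRep (Fin 3)) (reg.β k))) /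
                  (∫ U : GaugeConfig 4 (2 * S + 1) (Matrix.specialUnitaryGroup (Fin 3) ℂ),
                      ∏ f, ‖fermionDet (wilsonDirac (fundamentalRep (Fin 3)) U (reg.mcrit k + reg.a k * m f / reg.Zm k) 1)‖ ∂(wilsonMeasure (fundamentalRep (Fin 3)) (reg.β k))))).toReal ≤ δ j) ∧
      (∀ M : ℝ, M₀ < M → ∀ᶠ k : ℕ in Filter.atTop, ∀ S : ℕ, R ≤ reg.a k * (2 * S + 1) →
        (1 / 4 : ℝ) ≤
          (∫ U : GaugeConfig 4 (2 * S + 1) (Matrix.specialUnitaryGroup (Fin 3) ℂ), (if (fermionDet (wilsonDirac (fundamentalRep (Fin 3)) U (reg.mcrit k - reg.a k * M / reg.Zm k) 1)).re < 0 then (1 : ℝ) else 0) *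
                ∏ f, ‖fermionDet (wilsonDirac (fundamentalRep (Fin 3)) U (reg.mcrit k + reg.a k * m f / reg.Zm k) 1)‖ ∂(wilsonMeasure (fundamentalRep (Fin 3)) (reg.β k))) /
            (∫ U : GaugeConfig 4 (2 * S + 1) (Matrix.specialUnitaryGroup (Fin 3) ℂ),
                ∏ f, ‖fermionDet (wilsonDirac (fundamentalRep (Fin 3)) U (reg.mcrit k + reg.a k * m f / reg.Zm k) 1)‖ ∂(wilsonMeasure (fundamentalRep (Fin 3)) (reg.β k)))) := by
  have h₁ := stub_signMobility
  have h₂ := stub_concentration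
  have h₃ := stub_pinOfFloor
  have h₄ := stub_tunedStripWitness
  intro Nf hNf
  obtain ⟨reg, hms, has, M₀, hM₀, b₀, hb₀, ℓ, hℓ, hm⟩ := h₄ Nf hNf
  refine ⟨reg, hms, has, M₀, hM₀, b₀, hb₀, ℓ, hℓ, fun m hmM => ?_⟩
  obtain ⟨R, hR, Lb, d₀, p₀, θ, hLb, hd₀, hp₀, hθ, hθ8, hA, hFM⟩ := hm m hmM
  obtain ⟨R₀, hR₀, hpin⟩ := h₃ h₁ h₂ Nf reg M₀ m Lb d₀ p₀ θ R hLb hd₀ hp₀ hθ hθ8 hFM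
  refine ⟨max R R₀, lt_max_of_lt_left hR, fun ε hε => ?_, hpin (max R R₀) (le_max_right R R₀)⟩
  filter_upwards [hA ε hε] with k hk
  intro S hS
  exact hk S ((le_max_left R R₀).trans hS)

/-- Each child side is at least `1` when the parent sides are `≥ 2`. -/
theorem one_le_halfSides (s : Fin 4 → ℕ) (hs : ∀ i, 2 ≤ s i) (c : Fin 4 → Bool) (i : Fin 4) :
    1 ≤ halfSides s c i := by
  have h := hs i
  unfold halfSides
  split_ifs <;> omega

/-- Monotonicity of the kinetic edge in the sides: shrinking a box (to sides `≥ 1`) raises its edge,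
`Σ_i (1 − cos(π/s_i)) ≤ Σ_i (1 − cos(π/s'_i))` for `1 ≤ s'_i ≤ s_i`. -/
theorem edge_mono {s s' : Fin 4 → ℕ} (h1 : ∀ i, 1 ≤ s' i) (hle : ∀ i, s' i ≤ s i) :
    ∑ i, (1 - Real.cos (Real.pi / s i)) ≤ ∑ i, (1 - Real.cos (Real.pi / s' i)) := by
  refine Finset.sum_le_sum fun i _ => ?_
  have hs'pos : (0 : ℝ) < s' i := by exact_mod_cast h1 i
  have hspos : (0 : ℝ) < s i := by exact_mod_cast lt_of_lt_of_le (h1 i) (hle i)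
  have hle' : (s' i : ℝ) ≤ s i := by exact_mod_cast hle i
  have hcos : Real.cos (Real.pi / s' i) ≤ Real.cos (Real.pi / s i) := by
    apply Real.cos_le_cos_of_nonneg_of_le_pi
    · positivity
    · rw [div_le_iff₀ hs'pos]
      have : (1 : ℝ) ≤ s' i := by exact_mod_cast h1 i
      nlinarith [Real.pi_pos]
    · exact div_le_div_of_nonneg_left Real.pi_pos.le hs'pos hle'
  linarith

/-- An exact eigenvector with eigenvalue `μ' − μ₀`, `|μ' − μ₀| < η`, is an `η`-near-kernel vector. -/
theorem near_of_eigen {ι : Type*} [Fintype ι] {v w : ι → ℂ} (hv : v ≠ 0) {μ₀ μ' η : ℝ}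
    (hw : w = ((μ' - μ₀ : ℝ) : ℂ) • v) (hη : |μ' - μ₀| < η) :
    ∑ p, ‖w p‖ ^ 2 < η ^ 2 * ∑ p, ‖v p‖ ^ 2 := by
  have hsum : ∑ p, ‖w p‖ ^ 2 = |μ' - μ₀| ^ 2 * ∑ p, ‖v p‖ ^ 2 := by
    rw [Finset.mul_sum]
    refine Finset.sum_congr rfl fun p _ => ?_
    rw [hw, Pi.smul_apply, smul_eq_mul, norm_mul, Complex.norm_real, Real.norm_eq_abs]
    ring
  have hpos : 0 < ∑ p, ‖v p‖ ^ 2 := by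
    obtain ⟨p, hp⟩ : ∃ p, v p ≠ 0 := Function.ne_iff.mp hv
    exact Finset.sum_pos' (fun q _ => by positivity) ⟨p, Finset.mem_univ _, by positivity⟩
  have habs : 0 ≤ |μ' - μ₀| := abs_nonneg _
  have hsq : |μ' - μ₀| ^ 2 < η ^ 2 := by
    have hη0 : 0 < η := lt_of_le_of_lt habs hη
    nlinarith
  rw [hsum]
  exact mul_lt_mul_of_pos_right hsq hpos

/-- **The planner's stub 1 (`reverseWegnerSojourn`), now a theorem from stubs 1a–1c.** A sign defect of the box `s`
(`2 ≤ s_i ≤ N`) at scale `j` and valence mass `μ` forces a crossing mass `μ₀ ∈ [μ, −edge(s)]` of the parent or of a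
child such that for every `η` and every `μ'` with `|μ' − μ₀| < η` THAT cell has an `η`-near-kernel (its kernel vector
at `μ₀`). -/
theorem reverseWegnerSojourn :
    ∀ (N : ℕ) [NeZero N] (U : GaugeConfig 4 N (Matrix.specialUnitaryGroup (Fin 3) ℂ)) (μ : ℝ) (j : ℕ)
      (s : Fin 4 → ℕ), (∀ i, 2 ≤ s i) → (∀ i, s i ≤ N) → IsSignDefect U μ j s →
      ∃ μ₀ : ℝ, μ ≤ μ₀ ∧ μ₀ ≤ -∑ i, (1 - Real.cos (Real.pi / s i)) ∧
        ∀ η μ' : ℝ, |μ' - μ₀| < η →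
          ((∃ v : {p // wilsonBox (0 : TorusSite 4 N) s p} → ℂ, v ≠ 0 ∧
              ∑ p, ‖(wilsonCell U μ' 0 s).mulVec v p‖ ^ 2 < η ^ 2 * ∑ p, ‖v p‖ ^ 2) ∨
            ∃ c : Fin 4 → Bool, ∃ v : {p // wilsonBox (halfCorner s c : TorusSite 4 N) (halfSides s c) p} → ℂ,
              v ≠ 0 ∧ ∑ p, ‖(wilsonCell U μ' (halfCorner s c) (halfSides s c)).mulVec v p‖ ^ 2 <
                η ^ 2 * ∑ p, ‖v p‖ ^ 2) := by
  intro N _ U μ j s hs2 hsN hdef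
  obtain ⟨μ₀, hμ, hcross⟩ := stub_defectCrossing N U μ j s hdef
  have hs1 : ∀ i, 1 ≤ s i := fun i => le_trans (by norm_num) (hs2 i)
  rcases hcross with hpar | ⟨c, hch⟩
  · -- the parent crosses at μ₀
    have hedge := stub_kineticEdgeCell stub_boxGroundState N U μ₀ 0 s hsN hpar
    obtain ⟨v, hv, hker⟩ := Matrix.exists_mulVec_eq_zero_iff.mpr hpar
    refine ⟨μ₀, hμ, by linarith, fun η μ' hη => Or.inl ⟨v, hv, ?_⟩⟩
    exact near_of_eigen hv (stub_sojourn N U μ₀ μ' 0 s v hker) hη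
  · -- the child `c` crosses at μ₀
    have hsN' : ∀ i, halfSides s c i ≤ N := fun i => le_trans (halfSides_le s c i) (hsN i)
    have hedge := stub_kineticEdgeCell stub_boxGroundState N U μ₀ (halfCorner s c) (halfSides s c) hsN' hch
    have hmono := edge_mono (s := s) (s' := halfSides s c) (one_le_halfSides s hs2 c) (halfSides_le s c)
    obtain ⟨v, hv, hker⟩ := Matrix.exists_mulVec_eq_zero_iff.mpr hch
    refine ⟨μ₀, hμ, by linarith, fun η μ' hη => Or.inr ⟨c, v, hv, ?_⟩⟩
    exact near_of_eigen hv (stub_sojourn N U μ₀ μ' (halfCorner s c) (halfSides s c) v hker) hη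

/-! ## The composition (PROVED, no `sorry`): the stubs imply the crux, by name -/

/-- `NegativeCellsDilute` from exactly `reverseWegnerSojourn` (= stubs 1a–1c), `stub_reverseWegnerCount`,
`pinnedStripLaw` (= stubs 3a–3d) — pure logic (planner's composition, unchanged): the transfer's witness and pin pass through;
at `(ε, k, S)` the transfer's `η, δ` serve clause (a) because the defect event of a window box forces a sojourn
(`2 ≤ b₀ 2^j ≤ s_i ≤ N`, `μ₀ ≤ −edge`) and such events are dominated by the strip statistic (stub 2 with
`E := (∃ f, IsSignDefect U (m_f) j s)`), which (a⁺) bounds by `δ_j`. -/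
theorem NegativeCellsDilute_of : NegativeCellsDilute := by
  have h₁ := reverseWegnerSojourn
  have h₂ := stub_reverseWegnerCount
  have h₃ := pinnedStripLaw
  intro Nf hNf
  obtain ⟨reg, hms, has, M₀, hM₀, b₀, hb₀, ℓ, hℓ, hm⟩ := h₃ Nf hNf
  refine ⟨reg, hms, has, M₀, hM₀, b₀, hb₀, ℓ, hℓ, fun m hmpos => ?_⟩
  obtain ⟨R, hR, hA, hB⟩ := hm m hmpos
  refine ⟨R, hR, fun ε hε => ?_, hB⟩
  filter_upwards [hA ε hε] with k hk
  intro S hS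
  dsimp only
  obtain ⟨η, hη, δ, -, hδε, hbox⟩ := hk S hS
  refine ⟨δ, hδε, fun j hj s hs => ?_⟩
  have hs2 : ∀ i, 2 ≤ s i := fun i =>
    le_trans hb₀ (le_trans (Nat.le_mul_of_pos_right _ (Nat.two_pow_pos j)) (hs i).1)
  have hsN : ∀ i, s i ≤ 2 * S + 1 := fun i => (hs i).2.2.1
  refine le_trans (h₂ (2 * S + 1) (reg.β k) Nf (fun f => reg.mcrit k + reg.a k * m f / reg.Zm k) s η hη
    (fun U => ∃ f, IsSignDefect U (reg.mcrit k + reg.a k * m f / reg.Zm k) j s) ?_) (hbox j hj s hs)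
  rintro U ⟨f, hf⟩
  obtain ⟨μ₀, hμ, hedge, hsoj⟩ := h₁ (2 * S + 1) U _ j s hs2 hsN hf
  exact ⟨f, μ₀, hμ, hedge, fun μ' hμ' => hsoj η μ' hμ'⟩

end Summit.QuantumFields.QCD.Cruxes.NegativeCellsDilute.MassWegnerCellIndex

end
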